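import Literature.MathematicalPhysics.KineticTheory.InfiniteChainDynamics
import HarnessLib

/-!
# Stub CVS-M `stub_bondForceVariance_of_identity` of line `Sketch`, crux
`EmbeddedDrudeMourre.DrudeDissolution` (stmt-AtomisticToContinuum-12593): the moment algebra turning
the DLR bond-force identity into `∫ V'(r₀)² dμ = O(T)`

Pinned anharmonic chain `U(q) = ω₂q²/2 + lam q⁴/4`, `V(r) = r²/2 + βr⁴/4` (`ω₂, lam, β > 0`), so
`U'(q) = ω₂q + lam q³`, `V'(r) = r + βr³`, `V''(r) = 1 + 3βr²`. With `q_x := (σ x).1`,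
`r₀ := q₁ − q₀`, `r₁ := q₂ − q₁`, `r₋₁ := q₀ − q₋₁`, `a := V'(r₀)`, `b := V'(r₁)`, `c := V'(r₋₁)`,
`d := U'(q₁) − U'(q₀)`, the lead's stub `stub_bondForceIdentity` supplies, for a shift-invariant DLR
state `μ` at temperature `T`, the integration-by-parts identity `2T ∫ V''(r₀) = ∫ a (d + 2a − b − c)`,
the integrability of the moments involved and the shift equalities `∫ b² = ∫ a²`, `∫ c² = ∫ a²`.
This file is the pure measure-theoretic algebra: from these HYPOTHESES (for an arbitrary probability
measure `μ` on `ChainConfig`), `∫ a² dμ ≤ B·T` for `0 < T < T₁ := ω₂/(12β)` with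
`B := 4/ω₂ + 24β/lam`.

Proof. Pointwise `a d = (r₀² + βr₀⁴)(ω₂ + lam (q₁² + q₁q₀ + q₀²))` and
`q₁² + q₁q₀ + q₀² = r₀²/4 + ¾(q₁ + q₀)²`, whence `a d ≥ ω₂ r₀² + (lam/4) r₀⁴ + (βlam/4) r₀⁶`;
`a b ≤ (a² + b²)/2`, `a c ≤ (a² + c²)/2` integrate (shift equalities) to `∫ab ≤ ∫a²`, `∫ac ≤ ∫a²`;
so the identity gives
`ω₂∫r₀² + (lam/4)∫r₀⁴ + (βlam/4)∫r₀⁶ ≤ ∫ad = 2T(1 + 3β∫r₀²) − 2∫a² + ∫ab + ∫ac ≤ 2T + 6βT∫r₀²`,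
and `6βT ≤ ω₂/2` for `T < T₁`; hence `∫r₀² ≤ 4T/ω₂`, `∫r₀⁴ ≤ 8T/lam`, `∫r₀⁶ ≤ 8T/(βlam)` and
`∫a² = ∫r₀² + 2β∫r₀⁴ + β²∫r₀⁶ ≤ (4/ω₂ + 24β/lam) T`.

## Contents
* `bondForceVariance_pointwise` — the polynomial inequality
  `a d ≥ ω₂r₀² + (lam/4)r₀⁴ + (βlam/4)r₀⁶`;
* `bondForceVariance_integral_mul_le` — `∫ a e ≤ ∫ a²` when `∫ e² = ∫ a²`;
* `bondForceVariance_of_moments` — the abstract moment algebra for functions `r a b c d` on a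
  probability space;
* `stub_bondForceVariance_of_identity` — the registered stub, verbatim.
-/

noncomputable section

open MeasureTheory

namespace Summit.AtomisticToContinuum.FouriersLaw.Theorems.DrudeDissolution.LineSketch

open Literature.MathematicalPhysics.KineticTheory.HeatConduction

/-- Pointwise coercivity of the product bond force × pinning-force difference: for
`ω₂, lam, β ≥ 0`, `r = q₁ − q₀`, `U'(q) = ω₂ q + lam q³`,
`(r + βr³)(U'(q₁) − U'(q₀)) ≥ ω₂ r² + (lam/4) r⁴ + (βlam/4) r⁶`
(because `U'(q₁) − U'(q₀) = r (ω₂ + lam (q₁² + q₁q₀ + q₀²))` and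
`q₁² + q₁q₀ + q₀² = r²/4 + ¾(q₁+q₀)²`). [folklore] -/
theorem bondForceVariance_pointwise {ω₂ lam β : ℝ} (hω : 0 ≤ ω₂) (hl : 0 ≤ lam) (hβ : 0 ≤ β)
    (q₀ q₁ : ℝ) :
    ω₂ * (q₁ - q₀) ^ 2 + lam / 4 * (q₁ - q₀) ^ 4 + β * lam / 4 * (q₁ - q₀) ^ 6 ≤
      ((q₁ - q₀) + β * (q₁ - q₀) ^ 3) *
        ((ω₂ * q₁ + lam * q₁ ^ 3) - (ω₂ * q₀ + lam * q₀ ^ 3)) := by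
  have key : ((q₁ - q₀) + β * (q₁ - q₀) ^ 3) *
        ((ω₂ * q₁ + lam * q₁ ^ 3) - (ω₂ * q₀ + lam * q₀ ^ 3)) -
      (ω₂ * (q₁ - q₀) ^ 2 + lam / 4 * (q₁ - q₀) ^ 4 + β * lam / 4 * (q₁ - q₀) ^ 6) =
      β * ω₂ * (q₁ - q₀) ^ 4 +
        ((q₁ - q₀) ^ 2 + β * (q₁ - q₀) ^ 4) * lam * (3 / 4) * (q₁ + q₀) ^ 2 := by
    ring
  have h1 : 0 ≤ β * ω₂ * (q₁ - q₀) ^ 4 := by positivity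
  have h2 : 0 ≤ ((q₁ - q₀) ^ 2 + β * (q₁ - q₀) ^ 4) * lam * (3 / 4) * (q₁ + q₀) ^ 2 := by
    positivity
  linarith

/-- `2ae ≤ a² + e²` integrated: if `a²`, `e²`, `a e` are integrable and `∫ e² = ∫ a²` then
`∫ a e ≤ ∫ a²`. [folklore] -/
theorem bondForceVariance_integral_mul_le {α : Type*} [MeasurableSpace α] {μ : Measure α}
    {a e : α → ℝ} (hA : Integrable (fun x => a x ^ 2) μ) (hE : Integrable (fun x => e x ^ 2) μ)
    (hAE : Integrable (fun x => a x * e x) μ) (hEE : ∫ x, e x ^ 2 ∂μ = ∫ x, a x ^ 2 ∂μ) :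
    ∫ x, a x * e x ∂μ ≤ ∫ x, a x ^ 2 ∂μ := by
  have i3 : Integrable (fun x => (a x ^ 2 + e x ^ 2) / 2) μ := (hA.add hE).div_const 2
  have hpt : ∀ x, a x * e x ≤ (a x ^ 2 + e x ^ 2) / 2 := fun x => by
    nlinarith [sq_nonneg (a x - e x)]
  have h1 : ∫ x, a x * e x ∂μ ≤ ∫ x, (a x ^ 2 + e x ^ 2) / 2 ∂μ := integral_mono hAE i3 hpt
  have h2 : ∫ x, (a x ^ 2 + e x ^ 2) / 2 ∂μ = ∫ x, a x ^ 2 ∂μ := by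
    rw [integral_div, integral_add hA hE, hEE]; ring
  linarith

/-- **Moment algebra.** On a probability space, functions `r a b c d` with `a = r + βr³`,
`a d ≥ ω₂r² + (lam/4)r⁴ + (βlam/4)r⁶` pointwise, the listed moments integrable, `∫b² = ∫a² = ∫c²`
and the identity `2T ∫(1 + 3βr²) = ∫ a(d + 2a − b − c)` satisfy `∫a² ≤ (4/ω₂ + 24β/lam) T` as soon
as `T < ω₂/(12β)` (`ω₂, lam, β > 0`). [folklore] -/
theorem bondForceVariance_of_moments {α : Type*} [MeasurableSpace α] {μ : Measure α}
    [IsProbabilityMeasure μ] {ω₂ lam β T : ℝ} (hω : 0 < ω₂) (hl : 0 < lam) (hβ : 0 < β)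
    (hTlt : T < ω₂ / (12 * β)) (r a b c d : α → ℝ)
    (ha : ∀ x, a x = r x + β * r x ^ 3)
    (hd : ∀ x, ω₂ * r x ^ 2 + lam / 4 * r x ^ 4 + β * lam / 4 * r x ^ 6 ≤ a x * d x)
    (hr2 : Integrable (fun x => r x ^ 2) μ) (hr4 : Integrable (fun x => r x ^ 4) μ)
    (hr6 : Integrable (fun x => r x ^ 6) μ)
    (hA : Integrable (fun x => a x ^ 2) μ) (hB : Integrable (fun x => b x ^ 2) μ)
    (hC : Integrable (fun x => c x ^ 2) μ)
    (hAB : Integrable (fun x => a x * b x) μ) (hAC : Integrable (fun x => a x * c x) μ)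
    (hAD : Integrable (fun x => a x * d x) μ)
    (hBB : ∫ x, b x ^ 2 ∂μ = ∫ x, a x ^ 2 ∂μ) (hCC : ∫ x, c x ^ 2 ∂μ = ∫ x, a x ^ 2 ∂μ)
    (hI : 2 * T * ∫ x, (1 + 3 * β * r x ^ 2) ∂μ =
      ∫ x, a x * (d x + 2 * a x - b x - c x) ∂μ) :
    ∫ x, a x ^ 2 ∂μ ≤ (4 / ω₂ + 24 * β / lam) * T := by
  -- the left-hand side of the identity
  have hL : ∫ x, (1 + 3 * β * r x ^ 2) ∂μ = 1 + 3 * β * ∫ x, r x ^ 2 ∂μ := by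
    rw [integral_add (integrable_const _) (hr2.const_mul _), integral_const_mul]
    simp
  -- the right-hand side of the identity
  have i1 : Integrable (fun x => a x * d x + 2 * a x ^ 2) μ := hAD.add (hA.const_mul 2)
  have i2 : Integrable (fun x => a x * d x + 2 * a x ^ 2 - a x * b x) μ := i1.sub hAB
  have hR : ∫ x, a x * (d x + 2 * a x - b x - c x) ∂μ =
      ∫ x, a x * d x ∂μ + 2 * ∫ x, a x ^ 2 ∂μ - ∫ x, a x * b x ∂μ - ∫ x, a x * c x ∂μ := by
    have h : (fun x => a x * (d x + 2 * a x - b x - c x)) =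
        fun x => a x * d x + 2 * a x ^ 2 - a x * b x - a x * c x := by
      funext x; ring
    rw [h, integral_sub i2 hAC, integral_sub i1 hAB, integral_add hAD (hA.const_mul 2),
      integral_const_mul]
  -- `∫ab ≤ ∫a²`, `∫ac ≤ ∫a²`
  have hab := bondForceVariance_integral_mul_le hA hB hAB hBB
  have hac := bondForceVariance_integral_mul_le hA hC hAC hCC
  -- the coercive lower bound for `∫ad`
  have j1 : Integrable (fun x => ω₂ * r x ^ 2 + lam / 4 * r x ^ 4) μ :=
    (hr2.const_mul _).add (hr4.const_mul _)
  have j2 : Integrable (fun x => ω₂ * r x ^ 2 + lam / 4 * r x ^ 4 + β * lam / 4 * r x ^ 6) μ :=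
    j1.add (hr6.const_mul _)
  have hADge : ω₂ * ∫ x, r x ^ 2 ∂μ + lam / 4 * ∫ x, r x ^ 4 ∂μ + β * lam / 4 * ∫ x, r x ^ 6 ∂μ ≤
      ∫ x, a x * d x ∂μ := by
    have h1 : ∫ x, (ω₂ * r x ^ 2 + lam / 4 * r x ^ 4 + β * lam / 4 * r x ^ 6) ∂μ =
        ω₂ * ∫ x, r x ^ 2 ∂μ + lam / 4 * ∫ x, r x ^ 4 ∂μ + β * lam / 4 * ∫ x, r x ^ 6 ∂μ := by
      rw [integral_add j1 (hr6.const_mul _), integral_add (hr2.const_mul _) (hr4.const_mul _),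
        integral_const_mul, integral_const_mul, integral_const_mul]
    rw [← h1]
    exact integral_mono j2 hAD hd
  -- nonnegativity of the even moments
  have hX2 : 0 ≤ ∫ x, r x ^ 2 ∂μ := integral_nonneg (fun x => by positivity)
  have hX4 : 0 ≤ ∫ x, r x ^ 4 ∂μ := integral_nonneg (fun x => by positivity)
  have hX6 : 0 ≤ ∫ x, r x ^ 6 ∂μ := integral_nonneg (fun x => by positivity)
  -- `∫a²` in terms of the moments
  have k1 : Integrable (fun x => r x ^ 2 + 2 * β * r x ^ 4) μ := hr2.add (hr4.const_mul _)
  have hA2 : ∫ x, a x ^ 2 ∂μ =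
      ∫ x, r x ^ 2 ∂μ + 2 * β * ∫ x, r x ^ 4 ∂μ + β ^ 2 * ∫ x, r x ^ 6 ∂μ := by
    have h : (fun x => a x ^ 2) = fun x => r x ^ 2 + 2 * β * r x ^ 4 + β ^ 2 * r x ^ 6 := by
      funext x; rw [ha]; ring
    rw [h, integral_add k1 (hr6.const_mul _), integral_add hr2 (hr4.const_mul _),
      integral_const_mul, integral_const_mul]
  -- the real arithmetic
  have hTβ : 12 * β * T < ω₂ := by
    have := (lt_div_iff₀ (by positivity : (0 : ℝ) < 12 * β)).1 hTlt
    linarith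
  have hmain : ω₂ * ∫ x, r x ^ 2 ∂μ + lam / 4 * ∫ x, r x ^ 4 ∂μ + β * lam / 4 * ∫ x, r x ^ 6 ∂μ ≤
      2 * T + 6 * β * T * ∫ x, r x ^ 2 ∂μ := by
    rw [hL, hR] at hI
    linarith
  have hhalf : 12 * β * T * ∫ x, r x ^ 2 ∂μ ≤ ω₂ * ∫ x, r x ^ 2 ∂μ :=
    mul_le_mul_of_nonneg_right hTβ.le hX2
  have h2 : 0 ≤ ω₂ * ∫ x, r x ^ 2 ∂μ := mul_nonneg hω.le hX2
  have h4 : 0 ≤ lam * ∫ x, r x ^ 4 ∂μ := mul_nonneg hl.le hX4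
  have h6 : 0 ≤ β * lam * ∫ x, r x ^ 6 ∂μ := mul_nonneg (mul_nonneg hβ.le hl.le) hX6
  have hm2 : ω₂ * ∫ x, r x ^ 2 ∂μ ≤ 4 * T := by linarith
  have hm4 : lam * ∫ x, r x ^ 4 ∂μ ≤ 8 * T := by linarith
  have hm6 : β * lam * ∫ x, r x ^ 6 ∂μ ≤ 8 * T := by linarith
  have e2 : ∫ x, r x ^ 2 ∂μ ≤ 4 / ω₂ * T := by
    rw [div_mul_eq_mul_div, le_div_iff₀ hω]
    linarith
  have e4 : 2 * β * ∫ x, r x ^ 4 ∂μ ≤ 16 * β / lam * T := by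
    rw [div_mul_eq_mul_div, le_div_iff₀ hl]
    have := mul_le_mul_of_nonneg_left hm4 (by positivity : (0 : ℝ) ≤ 2 * β)
    linarith
  have e6 : β ^ 2 * ∫ x, r x ^ 6 ∂μ ≤ 8 * β / lam * T := by
    rw [div_mul_eq_mul_div, le_div_iff₀ hl]
    have := mul_le_mul_of_nonneg_left hm6 hβ.le
    linarith
  have hB : (4 / ω₂ + 24 * β / lam) * T = 4 / ω₂ * T + 16 * β / lam * T + 8 * β / lam * T := by
    ring
  rw [hA2, hB]
  linarith

/-- **CVS-M `stub_bondForceVariance_of_identity` — moment algebra: the identity forces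
`∫V'(r₀)² = O(T)`.** For reals `ω₂, lam, β > 0` there are `B` and `T₁ > 0` (here
`B = 4/ω₂ + 24β/lam`, `T₁ = ω₂/(12β)`) such that for every `T ∈ (0, T₁)` and every probability
measure `μ` on `ChainConfig` satisfying the conclusion of `stub_bondForceIdentity` at `(T, μ)`
(integrability clauses, the two shift-invariance equalities and the identity
`2T ∫ V''(r₀) = ∫ V'(r₀)(U'(q₁) − U'(q₀) + 2V'(r₀) − V'(r₁) − V'(r₋₁))`): `∫ V'(r₀)² dμ ≤ B·T`.
Instance `r := q₁ − q₀`, `a := V'(r₀)`, `b := V'(r₁)`, `c := V'(r₋₁)`, `d := U'(q₁) − U'(q₀)` of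
`bondForceVariance_of_moments`, the pointwise coercivity being `bondForceVariance_pointwise`.
[folklore] -/
theorem stub_bondForceVariance_of_identity :
    ∀ ω₂ lam β : ℝ, 0 < ω₂ → 0 < lam → 0 < β → ∃ B T₁ : ℝ, 0 < T₁ ∧
      ∀ (T : ℝ) (μ : MeasureTheory.Measure Literature.MathematicalPhysics.KineticTheory.HeatConduction.ChainConfig),
        0 < T → T < T₁ → MeasureTheory.IsProbabilityMeasure μ →
        (∀ k : ℕ, k ≤ 6 → MeasureTheory.Integrable
          (fun σ : Literature.MathematicalPhysics.KineticTheory.HeatConduction.ChainConfig =>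
            ((σ 1).1 - (σ 0).1) ^ k) μ) →
        MeasureTheory.Integrable (fun σ : Literature.MathematicalPhysics.KineticTheory.HeatConduction.ChainConfig =>
          ((σ 1).1 - (σ 0).1 + β * ((σ 1).1 - (σ 0).1) ^ 3) ^ 2) μ →
        MeasureTheory.Integrable (fun σ : Literature.MathematicalPhysics.KineticTheory.HeatConduction.ChainConfig =>
          ((σ 2).1 - (σ 1).1 + β * ((σ 2).1 - (σ 1).1) ^ 3) ^ 2) μ →
        MeasureTheory.Integrable (fun σ : Literature.MathematicalPhysics.KineticTheory.HeatConduction.ChainConfig =>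
          ((σ 0).1 - (σ (-1)).1 + β * ((σ 0).1 - (σ (-1)).1) ^ 3) ^ 2) μ →
        MeasureTheory.Integrable (fun σ : Literature.MathematicalPhysics.KineticTheory.HeatConduction.ChainConfig =>
          ((σ 1).1 - (σ 0).1 + β * ((σ 1).1 - (σ 0).1) ^ 3) *
            ((σ 2).1 - (σ 1).1 + β * ((σ 2).1 - (σ 1).1) ^ 3)) μ →
        MeasureTheory.Integrable (fun σ : Literature.MathematicalPhysics.KineticTheory.HeatConduction.ChainConfig =>
          ((σ 1).1 - (σ 0).1 + β * ((σ 1).1 - (σ 0).1) ^ 3) *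
            ((σ 0).1 - (σ (-1)).1 + β * ((σ 0).1 - (σ (-1)).1) ^ 3)) μ →
        MeasureTheory.Integrable (fun σ : Literature.MathematicalPhysics.KineticTheory.HeatConduction.ChainConfig =>
          ((σ 1).1 - (σ 0).1 + β * ((σ 1).1 - (σ 0).1) ^ 3) *
            ((ω₂ * (σ 1).1 + lam * (σ 1).1 ^ 3) - (ω₂ * (σ 0).1 + lam * (σ 0).1 ^ 3))) μ →
        (∫ σ, ((σ 2).1 - (σ 1).1 + β * ((σ 2).1 - (σ 1).1) ^ 3) ^ 2 ∂μ =
          ∫ σ, ((σ 1).1 - (σ 0).1 + β * ((σ 1).1 - (σ 0).1) ^ 3) ^ 2 ∂μ) →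
        (∫ σ, ((σ 0).1 - (σ (-1)).1 + β * ((σ 0).1 - (σ (-1)).1) ^ 3) ^ 2 ∂μ =
          ∫ σ, ((σ 1).1 - (σ 0).1 + β * ((σ 1).1 - (σ 0).1) ^ 3) ^ 2 ∂μ) →
        2 * T * ∫ σ, (1 + 3 * β * ((σ 1).1 - (σ 0).1) ^ 2) ∂μ =
          ∫ σ, ((σ 1).1 - (σ 0).1 + β * ((σ 1).1 - (σ 0).1) ^ 3) *
            (((ω₂ * (σ 1).1 + lam * (σ 1).1 ^ 3) - (ω₂ * (σ 0).1 + lam * (σ 0).1 ^ 3)) +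
              2 * ((σ 1).1 - (σ 0).1 + β * ((σ 1).1 - (σ 0).1) ^ 3) -
              ((σ 2).1 - (σ 1).1 + β * ((σ 2).1 - (σ 1).1) ^ 3) -
              ((σ 0).1 - (σ (-1)).1 + β * ((σ 0).1 - (σ (-1)).1) ^ 3)) ∂μ →
        ∫ σ, ((σ 1).1 - (σ 0).1 + β * ((σ 1).1 - (σ 0).1) ^ 3) ^ 2 ∂μ ≤ B * T := by
  intro ω₂ lam β hω hl hβ
  refine ⟨4 / ω₂ + 24 * β / lam, ω₂ / (12 * β), by positivity, ?_⟩
  intro T μ _hT hTlt hμ hk hA hB hC hAB hAC hAD hBB hCC hI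
  -- (stepwise: a one-shot `exact` makes the elaborator unfold real arithmetic while propagating
  -- the expected type)
  have key := bondForceVariance_of_moments (μ := μ) hω hl hβ hTlt (fun σ => (σ 1).1 - (σ 0).1)
    (fun σ => (σ 1).1 - (σ 0).1 + β * ((σ 1).1 - (σ 0).1) ^ 3)
    (fun σ => (σ 2).1 - (σ 1).1 + β * ((σ 2).1 - (σ 1).1) ^ 3)
    (fun σ => (σ 0).1 - (σ (-1)).1 + β * ((σ 0).1 - (σ (-1)).1) ^ 3)
    (fun σ => (ω₂ * (σ 1).1 + lam * (σ 1).1 ^ 3) - (ω₂ * (σ 0).1 + lam * (σ 0).1 ^ 3))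
    (fun _ => rfl) (fun σ => bondForceVariance_pointwise hω.le hl.le hβ.le (σ 0).1 (σ 1).1)
    (hk 2 (by norm_num)) (hk 4 (by norm_num)) (hk 6 le_rfl) hA hB hC hAB hAC hAD hBB hCC hI
  exact key

end Summit.AtomisticToContinuum.FouriersLaw.Theorems.DrudeDissolution.LineSketch
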